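import Summits.QuantumFields.YangMills.Theorems.BalabanUVNodesN11Thm2OfRecordIneq243
import Summits.QuantumFields.YangMills.Theorems.BalabanUVNodesN07Thm1ScaledInterfaceInstance
import Literature.MathematicalPhysics.QuantumFieldTheory.Balaban1983to89.B12CriticalPoint23

/-!
# DAG node N11 — [III] THEOREM 2 OF RECORD ON THE UNKEYED CARRIER IS UNSATISFIABLE: `¬ B14Thm2.Ineq243 (sect2DataOfRecord₁₃ θ p) L β E₁` for EVERY `L, β, E₁`,
# hence `¬ B14.Thm2Printed H033 (fun _ ↦ sect2DataOfRecord₁₃ θ p) L β κ₀`; and the 𝐑-half `Ineq244` dies of the unkeyed WITNESS alone (LOCATED repair: key the carrier)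

Cell `pub-ymgap`, YM-PLAN Track A (HUMAN RULING D-0062 ∕ D-0149), seat `pub-ymgap-dag-n11-w2` (g2), route `BalabanUVNodes`, key item K1⁷ `StabilityBAtRecordR13SepCoPH` =
stmt-QuantumFields-20542 (helper, count-neutral; own-lane A6 repair, step 1 of 3).  [III] = [Balaban1988Convergent].  Over this seat's g0 Defs `…Thm2Sect2DataOfRecordDefs`
(p588279: `sect2DataOfRecord₁₃`, `LevelDatum`, `EjSubOn`, `RjSubOn`) and g0 FILE 8 `…Thm2OfRecordIneq243` (p591376).

WHY THIS FILE.  g0's Defs state the cell's VERBATIM typing of Theorem 2 p. 263 (`B14.Thm2Printed` ∕ `B14Thm2.Ineq243` ∕ `Ineq244` over the abstract carrier `B14.Sect2Data`)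
at NODE 00's objects through the carrier `sect2DataOfRecord₁₃ θ p`, whose index `Ω := Σ k, LevelDatum θ p k` ranges over EVERY history `s`, EVERY exposed witness `t` (term
values), EVERY configuration `U`, EVERY region `Ω ⊂ T_η` and EVERY plaquette weight `φ`; g0 FILE 8 then CONSUMES `Ineq243 (sect2DataOfRecord₁₃ θ p) L β E₁` as a hypothesis
(`h243_at_record₁₃CoPH_of_ineq243OfRecord`, `ineq243_ineq244_of_thm2PrintedOfRecord`, `ineq249_action23_at_record₁₃CoPH_of_ineq243OfRecord`).  Print quantifies `E₁` over
MUCH LESS (p. 263 L4–6, L14, L21): «Let Ω be a domain from 𝒟_k contained in Bʲ(Λ_j), and let φ ∈ C₀^∞(Ω^∼), φ = 1 on Ω» · «E^{(j)}, R^{(j)}» = THE terms of `ρ_k` (ONE witness,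
the one §3 constructs) · «sufficiently regular configurations U_k = U_k(V), e.g. for V restricted by the characteristic functions in (2.18)».  THIS FILE SHOWS THE UNKEYED
CARRIER SENTENCE IS FALSE — so FILE 8's three consumers are VACUOUS (cell A6 rule, №189) at every `(θ, p)` holding one history of positive length, one non-stationary coupling
step and one non-trivial group element — and LOCATES the repair (step 2, this seat's INTENT-2: a carrier KEYED to a witness family `𝒯 k s` and a configuration class).

WHAT THIS FILE PROVES (0 `sorry`, 0 `def`, standard axioms; count-neutral; NOTHING of Bałaban's refuted or asserted — the refuted sentence is a MIS-SIZED TYPING, not print's).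
§1 generic: `EjSubOn_eq_zero_of_forall_false` (the Ω-restricted z-sum over a region no point meets vanishes, ANY witness) · `RjSubOn_eq_card_mul_of_const` (a range-sum of a
   constant) · `smearedWilson_indicator` (`A(𝟙_{p₀}, U) = 1 − Re tr U(∂p₀)`).
§2 at the ₁₃ objects, the 𝐄-half (the WEIGHT route): `eTerm_at_empty_region` (`eTerm j k ⟨k, ⟨s, t, U, ∅, w⟩⟩ = −β_j(g_{j−1})·A(w, U)`) · `gammaVol_at_empty_region` (`= 0`) ·
   ★ `not_ineq243_sect2DataOfRecord₁₃_of_datum` (ONE history `s` of length `k`, `1 ≤ j ≤ k ≤ K`, ONE pair `(U, w)` with `β_j(g_{j−1})·A(w, U) ≠ 0` ⇒ `¬ Ineq243 … L β E₁`) ·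
   ★★ `not_ineq243_sect2DataOfRecord₁₃` (the pair EXHIBITED: `U` = a non-trivial `g₀ ∈ SU(N)` on one bond of a plaquette `p₀`, `w = 𝟙_{p₀}`; hypotheses: `s`, `g_{j−1}^{−2} ≠ g_j^{−2}`,
   `g₀ ≠ 1`) · `not_ineq243_sect2DataOfRecord₁₃_of_window` (`g_{j−1}^{−2} ≠ g_j^{−2}` read from the β-window letters `0 < b′ ≤ g_i^{−2} − g_{i+1}^{−2}` of g0's capstones) ·
   ★★ `not_thm2Printed_sect2DataOfRecord₁₃` (⇒ `¬ B14.Thm2Printed H033 (fun _ : PUnit ↦ sect2DataOfRecord₁₃ θ p) L β κ₀` whenever `β < 1` and `H033` holds at the run's flow) ·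
   `plaq_nonempty` (`d = 4`: plaquettes exist) · `exists_ne_one_SU2` (`−1 ∈ SU(2)`, `−1 ≠ 1`) · ★★ `not_thm2Printed_sect2DataOfRecord₁₃_SU2` (at the group of record `N = 2` the
   only hypotheses left are `β < 1`, `H033` at the run's flow, one history of positive length and one non-stationary coupling step).
§3 the 𝐑-half (the WITNESS route): `ofBackgroundC_single_ne` (the embedding separates the single-bond configuration of `g₀ ≠ 1` from `1`) · ★ `not_ineq244_sect2DataOfRecord₁₃`
   (ONE history whose `Λ_j(s)` holds the non-empty site set of one domain `X₀ ∈ 𝐃_j`, `1 ≤ j ≤ k ≤ K`, `g₀ ≠ 1`: the UNKEYED witness `t_c.R := c·𝟙[φ ≠ (ι1, 0)]` at print's own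
   specialisation `Ω = T_η` of (2.46) gives `rTerm ≥ c` against a `c`-free right-hand side ⇒ `¬ Ineq244 … R₁ κ₀` for every `R₁, κ₀`).

HONEST FRAMING ∕ LOCATED.  The defect is the CARRIER's, and it is this seat's own (g0 Defs p588279): a carrier on which (2.43)–(2.44) can hold must (i) KEY the witness
(`E^{(j)}, R^{(j)}` of ONE term-value family per history — §3's construction, e.g. dag-n11-e's `chainWitness`), (ii) restrict `U` to a regular class, (iii) restrict `(Ω, φ)` as
print does (at `Ω = ∅`, «φ ∈ C₀^∞(Ω^∼)» forces `φ = 0`, which the weight route violates) or to print's own use `Ω = Bʲ(Λ_j)`, `φ = φ_j` ((2.45)–(2.46)).  The per-scale binders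
`h243 ∕ h244`, the §3 sentences and the (2.49) capstones of g0 FILES 1–7, 9–13 are NOT carrier sentences and stand; dag-n13-w3's consumers read per-scale producers only.
N11 NOT discharged; K1⁷ NOT closed; counts unmoved (typed 28∕28 · discharged 5∕27).  One finite four-torus programme at fixed `ε = L^{−K}`; R4 closes only the conditional
finite-𝕋⁴ rung `BalabanLadder.UV`; NOT ℝ⁴, NOT OS, NOT the Yang–Mills mass gap (Clay), which none of this proves.
Sources: [III] Thm 2 (2.43)–(2.44) p.263 with its preamble p.263 L4–6, (2.45)–(2.46) p.263, (2.2) p.255, (2.25) p.259, (2.30) p.260; [Balaban1987RG1] (0.2) p.252 (`Re tr`).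
-/

noncomputable section

open scoped BigOperators Matrix.Norms.L2Operator

namespace Summit.QuantumFields.YangMills.Theorems.BalabanUVNodesN11Thm2OfRecordUnkeyedCarrierUnsat

open Literature.MathematicalPhysics.QuantumFieldTheory.Balaban1983to89 Step B14.Eq225Concrete B14.LocalCoupling B14Thm2 Finset
open T4Continuum Node00 B15DeterminingSets
open BalabanUVNodesN11Thm2Sect2DataOfRecordDefs
open BalabanUVNodesN11Thm2OfRecordIneq243 (ineq243_ineq244_of_thm2PrintedOfRecord)
open Summit.QuantumFields.YangMills.BalabanUVNodes.N07Thm1ScaledInterfaceInstance (plaqHol_single_eq)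

/-! ## §1. Generic bookkeeping on a tower: empty point sets, constant range sums, indicator weights -/

section Generic

variable {P : Params} {G : Type*} [GaugeGroup G] {Φ 𝒢 𝔄 : Type*}
variable (T : LFTower P G Φ 𝒢 𝔄) (admE : (j : ℕ) → (T.sys j).Dom → T.Pt j → Bool)

/-- **The Ω-restricted z-sum of (2.43) over a region NO point meets is `0`** — whatever the witness, the range and the configuration.
[cite: Balaban1988Convergent, (2.43) p.263 (bookkeeping)] -/
theorem EjSubOn_eq_zero_of_forall_false (j : ℕ) (Ωz : T.Pt j → Bool) (U : GaugeField P 0 G) (hΩ : ∀ z, Ωz z = false) :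
    EjSubOn T admE j Ωz U = 0 := by
  unfold EjSubOn
  refine Finset.sum_eq_zero fun X _ => Finset.sum_eq_zero fun z _ => ?_
  rw [if_neg]
  rintro ⟨_, h⟩
  rw [hΩ z] at h
  exact Bool.false_ne_true h

/-- **A (2.44)-type range sum whose summand is the constant `c` on the range** equals `c` times the number of domains in the range. [cite: Balaban1988Convergent, (2.44) p.263 (bookkeeping)] -/
theorem RjSubOn_eq_card_mul_of_const (j : ℕ) (admΩ : (T.sys j).Dom → Bool) (U : GaugeField P 0 G) (c : ℝ)
    (hc : ∀ X, admΩ X = true → ((T.R j X (T.ofBackground U)).re - (T.R j X (T.ofBackground 1)).re) = c) :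
    RjSubOn T j admΩ U = ((Finset.univ.filter fun X => admΩ X = true).card : ℝ) * c := by
  classical
  unfold RjSubOn
  rw [← Finset.sum_filter, Finset.sum_congr rfl fun X hX => hc X (Finset.mem_filter.mp hX).2, Finset.sum_const, nsmul_eq_mul]

open Classical in
/-- **`A(𝟙_{p₀}, U) = 1 − Re tr U(∂p₀)`**: the Wilson action smeared with the indicator weight of one plaquette. [cite: Balaban1988Convergent, (2.25) p.259; Balaban1987RG1, (0.2) p.252] -/
theorem smearedWilson_indicator (p₀ : Plaq P 0) (U : GaugeField P 0 G) :
    smearedWilson (fun q => if q = p₀ then (1 : ℝ) else 0) U = 1 - reTr (GaugeField.plaqHol U p₀) := by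
  unfold smearedWilson
  rw [Finset.sum_eq_single p₀ (fun q _ hq => by simp only [if_neg hq, zero_mul]) (fun h => absurd (Finset.mem_univ _) h)]
  simp

end Generic

/-! ## §2. At the ₁₃ objects, the 𝐄-half: the weight route (`Ω = ∅`, `φ = 𝟙_{p₀}`, `U` = one non-trivial bond) -/

section AtRecord13

variable {F : T4Family} {N : ℕ} [NeZero N]
variable (θ : Stage13HParams F N) (p : B12.RunParams)

open Classical in
/-- **At the EMPTY region the (2.43) left-hand side of record is `−β_j(g_{j−1})·A(w, U)`** — for ANY witness `t`: no point `z` meets `Ω = ∅`, so the z-sum is gone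
(`EjSubOn_eq_zero_of_forall_false`) and only the weight term survives. [cite: Balaban1988Convergent, (2.43) p.263, (2.25) p.259] -/
theorem eTerm_at_empty_region (j k : ℕ) (s : SeqOfRecord F θ.ν θ.τ9.M (gOfRecord₁₃ F N θ.toStage13Params p) p.K k)
    (t : Sect2.TermValues (F.P p.K) (MatA N) (FluctV N) θ.τ9.M) (U : GaugeField (F.P p.K) 0 (SU N)) (w : Plaq (F.P p.K) 0 → ℝ) :
    (sect2DataOfRecord₁₃ θ p).eTerm j k ⟨k, ⟨s, t, U, ∅, w⟩⟩ =
      -((1 / gOfRecord₁₃ F N θ.toStage13Params p (j - 1) ^ 2 - 1 / gOfRecord₁₃ F N θ.toStage13Params p j ^ 2) * smearedWilson w U) := by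
  rw [eTerm_mk_self, EjSubOn_eq_zero_of_forall_false, zero_sub]
  intro z
  simp only [Set.mem_empty_iff_false, decide_false]

/-- **At the EMPTY region every volume `|Γ_n(s) ∩ Ω|` of record is `0`.** [cite: Balaban1988Convergent, (2.2) p.255, p.263 (bookkeeping)] -/
theorem gammaVol_at_empty_region (n k : ℕ) (s : SeqOfRecord F θ.ν θ.τ9.M (gOfRecord₁₃ F N θ.toStage13Params p) p.K k)
    (t : Sect2.TermValues (F.P p.K) (MatA N) (FluctV N) θ.τ9.M) (U : GaugeField (F.P p.K) 0 (SU N)) (w : Plaq (F.P p.K) 0 → ℝ) :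
    (sect2DataOfRecord₁₃ θ p).gammaVol n ⟨k, ⟨s, t, U, ∅, w⟩⟩ = 0 := by
  rw [gammaVol_mk]
  simp only [Set.inter_empty, Set.mem_empty_iff_false, Set.setOf_false, Set.ncard_empty, Nat.cast_zero]

/-- **★ THE UNKEYED CARRIER SENTENCE (2.43) OF RECORD DIES OF ONE DATUM**: if the run has a history `s` of some length `k` with `1 ≤ j ≤ k ≤ K` and a pair (configuration `U`,
weight `w`) with `β_j(g_{j−1})·A(w, U) ≠ 0`, then `Ineq243 (sect2DataOfRecord₁₃ θ p) L β E₁` FAILS for every `L, β, E₁`: at the datum `⟨s, t, U, ∅, w⟩` (any `t`) the left-hand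
side is `|β_j·A(w, U)| > 0` and the right-hand side is `E₁·Σ_n (L^{j−n})^β·0 = 0`. [cite: Balaban1988Convergent, Thm 2 (2.43) p.263 and its preamble p.263 L4–6] -/
theorem not_ineq243_sect2DataOfRecord₁₃_of_datum {j k : ℕ} (hj : 1 ≤ j) (hjk : j ≤ k) (hk : k ≤ p.K)
    (s : SeqOfRecord F θ.ν θ.τ9.M (gOfRecord₁₃ F N θ.toStage13Params p) p.K k) (U : GaugeField (F.P p.K) 0 (SU N)) (w : Plaq (F.P p.K) 0 → ℝ)
    (hne : (1 / gOfRecord₁₃ F N θ.toStage13Params p (j - 1) ^ 2 - 1 / gOfRecord₁₃ F N θ.toStage13Params p j ^ 2) * smearedWilson w U ≠ 0) (L β E₁ : ℝ) :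
    ¬ Ineq243 (sect2DataOfRecord₁₃ θ p) L β E₁ := by
  intro h
  have h1 := h j k ⟨k, ⟨s, Sect2.TermValues.zero, U, ∅, w⟩⟩ hj hjk hk
  rw [eTerm_at_empty_region, abs_neg] at h1
  have h0 : ∑ n ∈ Icc j k, (L ^ ((j : ℝ) - n)) ^ β * (sect2DataOfRecord₁₃ θ p).gammaVol n ⟨k, ⟨s, Sect2.TermValues.zero, U, ∅, w⟩⟩ = 0 :=
    Finset.sum_eq_zero fun n _ => by rw [gammaVol_at_empty_region, mul_zero]
  rw [h0, mul_zero] at h1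
  exact hne (abs_nonpos_iff.mp h1)

/-- **The lattice of record has plaquettes** (`d = 4`): the plaquette at the origin in the `(0, 1)`-plane of `T_η`. [cite: Balaban1987RG1, (0.1)–(0.2) pp.251–252 (bookkeeping)] -/
theorem plaq_nonempty (K : ℕ) : Nonempty (Plaq (F.P K) 0) :=
  ⟨⟨fun _ => 0, ⟨0, by rw [show (F.P K).d = 4 from rfl]; decide⟩, ⟨1, by rw [show (F.P K).d = 4 from rfl]; decide⟩, Fin.mk_lt_mk.mpr zero_lt_one⟩⟩

/-- **At the group of record `SU(2)` a non-trivial element: `−1 ∈ SU(2)`, `−1 ≠ 1`.** [cite: Balaban1987RG1, p.260 («restriction to the group SU(2) is superficial») (bookkeeping)] -/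
theorem exists_ne_one_SU2 : ∃ g₀ : SU 2, g₀ ≠ 1 := by
  have hmem : (-1 : Matrix (Fin 2) (Fin 2) ℂ) ∈ Matrix.specialUnitaryGroup (Fin 2) ℂ := by
    rw [Matrix.mem_specialUnitaryGroup_iff]
    refine ⟨?_, ?_⟩
    · rw [Matrix.mem_unitaryGroup_iff]
      simp
    · rw [Matrix.det_neg, Matrix.det_one, Fintype.card_fin]
      norm_num
  refine ⟨⟨-1, hmem⟩, fun h => ?_⟩
  have h00 := congrArg (fun g : SU 2 => (g : Matrix (Fin 2) (Fin 2) ℂ) 0 0) h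
  norm_num at h00

/-- **★★ (2.43) OF RECORD ON THE UNKEYED CARRIER IS FALSE**, the pair exhibited: `U` = the single-bond configuration carrying a NON-TRIVIAL `g₀ ∈ SU(N)` on the first bond of a
plaquette `p₀` (plaquette variable `g₀`, dag-n07-a's `plaqHol_single_eq`), `w = 𝟙_{p₀}` (so `A(w, U) = 1 − Re tr g₀ ≠ 0`, lit-balaban's `eq_one_of_reTr_eq_one_specialUnitaryGroup`);
hypotheses DISPLAYED: one history `s` of length `k`, `1 ≤ j ≤ k ≤ K`, the coupling step `g_{j−1}^{−2} − g_j^{−2} ≠ 0`, `g₀ ≠ 1` (the group is non-trivial, e.g. `N ≥ 2`: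
`exists_ne_one_SU2`); the plaquette is free (`plaq_nonempty`).  Conclusion for EVERY `L, β, E₁`. [cite: Balaban1988Convergent, Thm 2 (2.43) p.263 and its preamble p.263 L4–6; Balaban1987RG1, (0.2) p.252] -/
theorem not_ineq243_sect2DataOfRecord₁₃ {j k : ℕ} (hj : 1 ≤ j) (hjk : j ≤ k) (hk : k ≤ p.K)
    (s : SeqOfRecord F θ.ν θ.τ9.M (gOfRecord₁₃ F N θ.toStage13Params p) p.K k)
    (hβj : 1 / gOfRecord₁₃ F N θ.toStage13Params p (j - 1) ^ 2 - 1 / gOfRecord₁₃ F N θ.toStage13Params p j ^ 2 ≠ 0)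
    (g₀ : SU N) (hg₀ : g₀ ≠ 1) (L β E₁ : ℝ) :
    ¬ Ineq243 (sect2DataOfRecord₁₃ θ p) L β E₁ := by
  classical
  obtain ⟨p₀⟩ := plaq_nonempty (F := F) p.K
  refine not_ineq243_sect2DataOfRecord₁₃_of_datum θ p hj hjk hk s
    (fun b : PBond (F.P p.K) 0 => if b.src = p₀.src ∧ b.dir = p₀.μ then g₀ else 1) (fun q => if q = p₀ then (1 : ℝ) else 0) ?_ L β E₁
  have hA : smearedWilson (fun q => if q = p₀ then (1 : ℝ) else 0)
      (fun b : PBond (F.P p.K) 0 => if b.src = p₀.src ∧ b.dir = p₀.μ then g₀ else (1 : SU N)) = 1 - reTr g₀ := by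
    rw [smearedWilson_indicator]
    congr 2
    exact plaqHol_single_eq p₀.src p₀.hμν g₀
  have hre : 1 - reTr g₀ ≠ 0 := fun h => hg₀ (B12CriticalPoint23.eq_one_of_reTr_eq_one_specialUnitaryGroup g₀ (by linarith))
  rw [hA]
  exact mul_ne_zero hβj hre

/-- **The coupling step read from the β-WINDOW LETTERS of g0's capstones**: `0 < b′ ≤ g_i^{−2} − g_{i+1}^{−2}` for `i < K′` gives `g_{j−1}^{−2} − g_j^{−2} ≠ 0` for
`1 ≤ j ≤ K′`. [cite: Balaban1987RG1, (0.31) p.259 (bookkeeping)] -/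
theorem couplingStep_ne_zero_of_window {j K' : ℕ} (hj : 1 ≤ j) (hjK : j ≤ K') {b' : ℝ} (hb' : 0 < b')
    (hlb : ∀ i, i < K' → b' ≤ 1 / gOfRecord₁₃ F N θ.toStage13Params p i ^ 2 - 1 / gOfRecord₁₃ F N θ.toStage13Params p (i + 1) ^ 2) :
    1 / gOfRecord₁₃ F N θ.toStage13Params p (j - 1) ^ 2 - 1 / gOfRecord₁₃ F N θ.toStage13Params p j ^ 2 ≠ 0 := by
  have h := hlb (j - 1) (by omega)
  rw [Nat.sub_add_cancel hj] at h
  exact ne_of_gt (lt_of_lt_of_le hb' h)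

/-- **(2.43) of record on the unkeyed carrier is false UNDER THE β-WINDOW LETTERS** (`0 < b′`, `hlb`, `k ≤ K′` — the letters g0's capstones display): only the history, the
non-trivial group element and a plaquette remain as hypotheses. [cite: Balaban1988Convergent, Thm 2 (2.43) p.263; Balaban1987RG1, (0.31) p.259] -/
theorem not_ineq243_sect2DataOfRecord₁₃_of_window {j k K' : ℕ} (hj : 1 ≤ j) (hjk : j ≤ k) (hk : k ≤ p.K) (hkK' : k ≤ K')
    (s : SeqOfRecord F θ.ν θ.τ9.M (gOfRecord₁₃ F N θ.toStage13Params p) p.K k) {b' : ℝ} (hb' : 0 < b')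
    (hlb : ∀ i, i < K' → b' ≤ 1 / gOfRecord₁₃ F N θ.toStage13Params p i ^ 2 - 1 / gOfRecord₁₃ F N θ.toStage13Params p (i + 1) ^ 2)
    (g₀ : SU N) (hg₀ : g₀ ≠ 1) (L β E₁ : ℝ) :
    ¬ Ineq243 (sect2DataOfRecord₁₃ θ p) L β E₁ :=
  not_ineq243_sect2DataOfRecord₁₃ θ p hj hjk hk s (couplingStep_ne_zero_of_window θ p hj (hjk.trans hkK') hb' hlb) g₀ hg₀ L β E₁

/-- **★★ THEOREM 2 OF RECORD ON THE UNKEYED CARRIER IS FALSE**: under print's guard `β < 1` and the hypothesis parameter `H033` of Theorem 1 holding at the run's flow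
(`flowOfRun g`, (0.20) free), `B14.Thm2Printed H033 (fun _ : PUnit ↦ sect2DataOfRecord₁₃ θ p) L β κ₀` would give `Ineq243` of record with SOME `E₁` (g0 FILE 8's
`ineq243_ineq244_of_thm2PrintedOfRecord`) — refuted above.  (For an `H033` failing at the run's flow the typed sentence is vacuously true and says nothing.)
[cite: Balaban1988Convergent, Thm 2 (2.43)–(2.44) p.263 and its preamble p.263 L4–6] -/
theorem not_thm2Printed_sect2DataOfRecord₁₃ (H033 : Flow → ℕ → Prop) {L β : ℝ} (κ₀ : ℕ) (hβ : β < 1)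
    (h033 : H033 (flowOfRun (gOfRecord₁₃ F N θ.toStage13Params p)) p.K) {j k : ℕ} (hj : 1 ≤ j) (hjk : j ≤ k) (hk : k ≤ p.K)
    (s : SeqOfRecord F θ.ν θ.τ9.M (gOfRecord₁₃ F N θ.toStage13Params p) p.K k)
    (hβj : 1 / gOfRecord₁₃ F N θ.toStage13Params p (j - 1) ^ 2 - 1 / gOfRecord₁₃ F N θ.toStage13Params p j ^ 2 ≠ 0)
    (g₀ : SU N) (hg₀ : g₀ ≠ 1) :
    ¬ B14.Thm2Printed H033 (fun _ : PUnit => sect2DataOfRecord₁₃ θ p) L β κ₀ := by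
  intro h
  obtain ⟨E₁, R₁, h243, -⟩ := ineq243_ineq244_of_thm2PrintedOfRecord θ p H033 h hβ h033
  exact not_ineq243_sect2DataOfRecord₁₃ θ p hj hjk hk s hβj g₀ hg₀ L β E₁ h243

/-- **At the group of record `N = 2`** the group-element hypothesis is free (`exists_ne_one_SU2`): Theorem 2 of record on the unkeyed carrier is false given only `β < 1`, `H033`
at the run's flow, one history of length `k ≥ j ≥ 1` and the coupling step `g_{j−1}^{−2} ≠ g_j^{−2}`. [cite: Balaban1988Convergent, Thm 2 (2.43)–(2.44) p.263; Balaban1987RG1, p.260] -/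
theorem not_thm2Printed_sect2DataOfRecord₁₃_SU2 (θ : Stage13HParams F 2) (p : B12.RunParams) (H033 : Flow → ℕ → Prop) {L β : ℝ} (κ₀ : ℕ) (hβ : β < 1)
    (h033 : H033 (flowOfRun (gOfRecord₁₃ F 2 θ.toStage13Params p)) p.K) {j k : ℕ} (hj : 1 ≤ j) (hjk : j ≤ k) (hk : k ≤ p.K)
    (s : SeqOfRecord F θ.ν θ.τ9.M (gOfRecord₁₃ F 2 θ.toStage13Params p) p.K k)
    (hβj : 1 / gOfRecord₁₃ F 2 θ.toStage13Params p (j - 1) ^ 2 - 1 / gOfRecord₁₃ F 2 θ.toStage13Params p j ^ 2 ≠ 0) :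
    ¬ B14.Thm2Printed H033 (fun _ : PUnit => sect2DataOfRecord₁₃ θ p) L β κ₀ := by
  obtain ⟨g₀, hg₀⟩ := exists_ne_one_SU2
  exact not_thm2Printed_sect2DataOfRecord₁₃ θ p H033 κ₀ hβ h033 hj hjk hk s hβj g₀ hg₀

end AtRecord13

/-! ## §3. At the ₁₃ objects, the 𝐑-half: the witness route (`Ω = T_η`, unkeyed `𝐑`-terms) -/

section RHalf

variable {F : T4Family} {N : ℕ} [NeZero N]
variable (θ : Stage13HParams F N) (p : B12.RunParams)

/-- **The embedding `(ιU, 0)` separates the single-bond configuration of a non-trivial `g₀` from `1`.** [cite: Balaban1988Convergent, (2.23) p.258 (bookkeeping)] -/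
theorem ofBackgroundC_single_ne {K : ℕ} (g₀ : SU N) (hg₀ : g₀ ≠ 1) (p₀ : Plaq (F.P K) 0) :
    Sect2.ofBackgroundC (P := F.P K) (ιSU N) (fun b : PBond (F.P K) 0 => if b.src = p₀.src ∧ b.dir = p₀.μ then g₀ else 1) ≠
      Sect2.ofBackgroundC (P := F.P K) (ιSU N) 1 := by
  intro h
  have h1 : (Sect2.ofBackgroundC (P := F.P K) (ιSU N) (fun b : PBond (F.P K) 0 => if b.src = p₀.src ∧ b.dir = p₀.μ then g₀ else 1)).1 ⟨p₀.src, p₀.μ⟩ =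
      (Sect2.ofBackgroundC (P := F.P K) (ιSU N) 1).1 ⟨p₀.src, p₀.μ⟩ := by rw [h]
  change ((ιSU N (if p₀.src = p₀.src ∧ p₀.μ = p₀.μ then g₀ else 1) : (MatA N)ˣ) : MatA N) = ((ιSU N 1 : (MatA N)ˣ) : MatA N) at h1
  rw [if_pos ⟨rfl, rfl⟩, coe_ιSU, coe_ιSU] at h1
  exact hg₀ (Subtype.ext h1)

open Classical in
/-- **★ (2.44) OF RECORD ON THE UNKEYED CARRIER IS FALSE — of the unkeyed WITNESS alone**, at print's own specialisation `Ω = T_η` of (2.46): given ONE history `s` of length `k`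
whose small-field region `Λ_j(s)` holds the (non-empty) site set of one domain `X₀ ∈ 𝐃_j`, `1 ≤ j ≤ k ≤ K`, and a non-trivial `g₀`, the witness `t_c` with
`𝐑^{(j)}(X, φ) := c·𝟙[φ ≠ (ι1, 0)]` (zero 𝐄, 𝐁) has `rTerm ≥ c` at `⟨s, t_c, U₀, T_η, w⟩` (`U₀` the single-bond configuration) against the `c`-free right-hand side
`R₁ g_j^{κ₀} Σ_n |Γ_n(s)|`; `c := that + 1`.  So no `R₁, κ₀` work. [cite: Balaban1988Convergent, Thm 2 (2.44) p.263, (2.46) p.263, (2.30) p.260] -/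
theorem not_ineq244_sect2DataOfRecord₁₃ {j k : ℕ} (hj : 1 ≤ j) (hjk : j ≤ k) (hk : k ≤ p.K)
    (s : SeqOfRecord F θ.ν θ.τ9.M (gOfRecord₁₃ F N θ.toStage13Params p) p.K k) (X₀ : (Sect2.domSys (F.P p.K) θ.τ9.M j).Dom)
    (hX₀ : Sect2.domSites (F.P p.K) θ.τ9.M j X₀ ⊆ s.Λ j) (hX₀' : (Sect2.domSites (F.P p.K) θ.τ9.M j X₀).Nonempty)
    (g₀ : SU N) (hg₀ : g₀ ≠ 1) (R₁ : ℝ) (κ₀ : ℕ) :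
    ¬ Ineq244 (sect2DataOfRecord₁₃ θ p) R₁ κ₀ := by
  intro h
  obtain ⟨p₀⟩ := plaq_nonempty (F := F) p.K
  -- the `c`-free right-hand side at `Ω = T_η`, the weight `w = 0` (unread by (2.44)), and the unkeyed witness `t_c`
  set w : Plaq (F.P p.K) 0 → ℝ := fun _ => 0 with hw
  set U₀ : GaugeField (F.P p.K) 0 (SU N) := fun b => if b.src = p₀.src ∧ b.dir = p₀.μ then g₀ else 1 with hU₀
  set Rhs : ℝ := R₁ * (gOfRecord₁₃ F N θ.toStage13Params p j) ^ κ₀ * ∑ n ∈ Icc j k,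
      (Set.ncard {y : Site (F.P p.K) n | B10Eq38TorusDomains.toFine n y ∈ gammaRegion s.Ω k n ∩ (Set.univ : Set (Site (F.P p.K) 0))} : ℝ) with hRhs
  set c : ℝ := |Rhs| + 1 with hc
  set tc : Sect2.TermValues (F.P p.K) (MatA N) (FluctV N) θ.τ9.M :=
    { E := fun _ _ _ _ _ => 0
      R := fun _ _ φ => if φ = Sect2.ofBackgroundC (P := F.P p.K) (ιSU N) 1 then 0 else (c : ℂ)
      B := fun _ _ _ _ => 0 } with htc
  have h1 := h j k ⟨k, ⟨s, tc, U₀, Set.univ, w⟩⟩ hj hjk hk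
  rw [rTerm_mk_self] at h1
  simp only [gammaVol_mk, sect2DataOfRecord₁₃_flow, flowOfRun_g] at h1
  -- the summand on the range is the constant `c`
  have hsep : Sect2.ofBackgroundC (P := F.P p.K) (ιSU N) U₀ ≠ Sect2.ofBackgroundC (P := F.P p.K) (ιSU N) 1 := by
    rw [hU₀]; exact ofBackgroundC_single_ne g₀ hg₀ p₀
  have hconst : ∀ X, decide (Sect2.domSites (F.P p.K) θ.τ9.M j X ⊆ s.Λ j ∧ (Sect2.domSites (F.P p.K) θ.τ9.M j X ∩ Set.univ).Nonempty) = true →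
      (((sect2TowerOfRecord F N (FluctV N) p.K (settingOfRecord₁₃ F N θ.toStage13Params p) (θ.rzAt p s) s tc).R j X
          ((sect2TowerOfRecord F N (FluctV N) p.K (settingOfRecord₁₃ F N θ.toStage13Params p) (θ.rzAt p s) s tc).ofBackground U₀)).re -
        ((sect2TowerOfRecord F N (FluctV N) p.K (settingOfRecord₁₃ F N θ.toStage13Params p) (θ.rzAt p s) s tc).R j X
          ((sect2TowerOfRecord F N (FluctV N) p.K (settingOfRecord₁₃ F N θ.toStage13Params p) (θ.rzAt p s) s tc).ofBackground 1)).re) = c := by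
    intro X _
    show (tc.R j X (Sect2.ofBackgroundC (ιSU N) U₀)).re - (tc.R j X (Sect2.ofBackgroundC (ιSU N) 1)).re = c
    simp [htc, if_neg hsep]
  rw [RjSubOn_eq_card_mul_of_const _ j _ U₀ c hconst] at h1
  -- the range holds `X₀`, so the left-hand side is at least `c`
  have hX₀mem : X₀ ∈ Finset.univ.filter fun X =>
      decide (Sect2.domSites (F.P p.K) θ.τ9.M j X ⊆ s.Λ j ∧ (Sect2.domSites (F.P p.K) θ.τ9.M j X ∩ Set.univ).Nonempty) = true := by
    rw [Finset.mem_filter, decide_eq_true_iff, Set.inter_univ]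
    exact ⟨Finset.mem_univ _, hX₀, hX₀'⟩
  have hcard : (1 : ℝ) ≤ ((Finset.univ.filter fun X =>
      decide (Sect2.domSites (F.P p.K) θ.τ9.M j X ⊆ s.Λ j ∧ (Sect2.domSites (F.P p.K) θ.τ9.M j X ∩ Set.univ).Nonempty) = true).card : ℝ) := by
    exact_mod_cast Finset.card_pos.mpr ⟨X₀, hX₀mem⟩
  have hcpos : 0 < c := by rw [hc]; positivity
  have hle : c ≤ ((Finset.univ.filter fun X =>
      decide (Sect2.domSites (F.P p.K) θ.τ9.M j X ⊆ s.Λ j ∧ (Sect2.domSites (F.P p.K) θ.τ9.M j X ∩ Set.univ).Nonempty) = true).card : ℝ) * c := by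
    nlinarith
  have h2 : c ≤ Rhs := le_trans (le_trans hle (le_abs_self _)) (by rw [hRhs]; exact h1)
  have h3 : Rhs ≤ |Rhs| := le_abs_self _
  linarith

end RHalf

end Summit.QuantumFields.YangMills.Theorems.BalabanUVNodesN11Thm2OfRecordUnkeyedCarrierUnsat

end
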